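import Summits.Parity.GeneralizedHardyLittlewood.Theorems.BeyondDiagonalBeatsQuarter.CornerWeightE
import Summits.Parity.GeneralizedHardyLittlewood.Theorems.BeyondDiagonalBeatsQuarter.KernelFormXSqTools
import HarnessLib

/-!
# Route `PrimeLevelFamEdge`, crux K_B (stmt-Parity-20343), line `diagonal_kernel_split`, helper H1
# (`CornerNegligibleXSq`), part 4: the two-variable Abel estimate

After the `τ`-decoupling (part 5) the corner is a combination of double sums
`U = Σ_{k₁,k₂ ≤ Y} a(k₁)a(k₂)ℓ(k₁)²ℓ(k₂)²E(αk₁k₂)` (`a = a_n` the twisted Möbius weights of part 3,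
`ℓ(k) = log(Y/k)`, `E` the corner weight of parts 1–2, `α = d²/Q²`). This file bounds such a sum for an
ARBITRARY sequence `a` in terms of (i) a uniform bound `B` for its partial sums `A(e) = Σ_{k≤e} a(k)` and
(ii) their smallness `η` beyond a threshold `K₁`:
* `abs_sum_Ioc_mul_prod_le` — discrete Abel summation against a product `f·h` of a non-negative
  antitone `f ≤ F` vanishing at the right end and a non-negative monotone `h ≤ H`: total variation
  `≤ 2FH`, so `|Σ_{u<e≤w} a(e)f(e)h(e)| ≤ sup_{u<e≤w}|A(e) − A(u)|·2FH`;
* **`abs_doubleSum_cornerE_le`** — `|U| ≤ S·2(log Y)²·(B√(2αK₁Y) + 2η(𝒲(1) + 1 + |log(2αY²)|/2))` with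
  `S = Σ_{k≤Y}|a(k)|ℓ(k)²`: the rows `k₁ ≤ K₁` only see arguments `αk₁k₂ ≤ 2αK₁Y` where `E ≤ √·`
  (`cornerE_le_sqrt`, `cornerE_mono`), the rows `k₁ > K₁` are Abel-summed in `k₁` where the partial
  sums are `η`-small. Choosing `K₁ ≈ e^{−T}/(αY)` makes both small (part 6).
Helper toward the heart stub (plan Ω, H1); closes nothing; standard axioms.
«The programme SEARCHES and TYPES; no claim about Landau–Siegel zeros, Theorems 1–2 of
arXiv:2211.02515 or a repaired Margin232 until a kernel theorem says so.»
-/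

noncomputable section

open Finset Real

namespace Summit.Parity.GeneralizedHardyLittlewood.Theorems.BeyondDiagonalBeatsQuarter.Corner

open KernelFormXSq (sum_Ioc_sub_succ sum_Ioc_mul_eq_abel)

/-! ### Discrete Abel summation against a product of monotone weights -/

/-- **Total variation of `f·h`**: for `f ≥ 0` antitone with `f ≤ F` and `h ≥ 0` monotone with `h ≤ H`
on `(u, w+1]`, `Σ_{u<e≤w} |f(e)h(e) − f(e+1)h(e+1)| ≤ 2FH`. [folklore] -/
theorem sum_abs_prod_sub_le {f h : ℕ → ℝ} {u w : ℕ} (huw : u ≤ w) {F H : ℝ}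
    (hf0 : ∀ e, 0 ≤ f e) (hfF : ∀ e, f e ≤ F) (hf : ∀ e, u < e → f (e + 1) ≤ f e)
    (hh0 : ∀ e, u < e → 0 ≤ h e) (hhH : ∀ e, u < e → e ≤ w + 1 → h e ≤ H)
    (hh : ∀ e, u < e → h e ≤ h (e + 1)) :
    ∑ e ∈ Ioc u w, |f e * h e - f (e + 1) * h (e + 1)| ≤ 2 * F * H := by
  have hF : 0 ≤ F := (hf0 0).trans (hfF 0)
  have hH : 0 ≤ H := (hh0 (u + 1) (Nat.lt_succ_self u)).trans (hhH (u + 1) (Nat.lt_succ_self u) (by omega))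
  have hterm : ∀ e ∈ Ioc u w, |f e * h e - f (e + 1) * h (e + 1)| ≤
      H * (f e - f (e + 1)) + F * (h (e + 1) - h e) := by
    intro e he
    have he' := Finset.mem_Ioc.1 he
    have h1 : f e * h e - f (e + 1) * h (e + 1) =
        (f e - f (e + 1)) * h e + f (e + 1) * (h e - h (e + 1)) := by ring
    rw [h1]
    have hfe : 0 ≤ f e - f (e + 1) := by linarith [hf e he'.1]
    have hhe : 0 ≤ h (e + 1) - h e := by linarith [hh e he'.1]
    calc |(f e - f (e + 1)) * h e + f (e + 1) * (h e - h (e + 1))|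
        ≤ |(f e - f (e + 1)) * h e| + |f (e + 1) * (h e - h (e + 1))| := abs_add_le _ _
      _ = (f e - f (e + 1)) * h e + f (e + 1) * (h (e + 1) - h e) := by
          rw [abs_mul, abs_mul, abs_of_nonneg hfe, abs_of_nonneg (hh0 e he'.1), abs_of_nonneg (hf0 _),
            abs_sub_comm, abs_of_nonneg hhe]
      _ ≤ (f e - f (e + 1)) * H + F * (h (e + 1) - h e) := by
          gcongr
          · exact hhH e he'.1 (by omega)
          · exact hfF _
      _ = H * (f e - f (e + 1)) + F * (h (e + 1) - h e) := by ring
  refine (Finset.sum_le_sum hterm).trans ?_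
  rw [Finset.sum_add_distrib, ← Finset.mul_sum, ← Finset.mul_sum, sum_Ioc_sub_succ f huw]
  have htel : ∑ e ∈ Ioc u w, (h (e + 1) - h e) = h (w + 1) - h (u + 1) := by
    have := sum_Ioc_sub_succ (fun e ↦ -h e) huw
    simp only [neg_sub_neg] at this
    exact this
  rw [htel]
  have h1 : f (u + 1) - f (w + 1) ≤ F := by linarith [hfF (u + 1), hf0 (w + 1)]
  have h2 : h (w + 1) - h (u + 1) ≤ H := by
    linarith [hhH (w + 1) (by omega) le_rfl, hh0 (u + 1) (Nat.lt_succ_self u)]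
  nlinarith

/-- **Abel bound against a product weight vanishing at the right end.** If
`|A(e) − A(u)| ≤ B` for `u < e ≤ w` (`A(e) = Σ_{k≤e} a(k)`), `f ≥ 0` antitone with `f ≤ F` and
`f(w+1) = 0`, `h ≥ 0` monotone with `h ≤ H` on `(u, w+1]`, then
`|Σ_{u<e≤w} a(e)f(e)h(e)| ≤ B·2FH`. [folklore] -/
theorem abs_sum_Ioc_mul_prod_le (a : ℕ → ℝ) {f h : ℕ → ℝ} {u w : ℕ} (huw : u ≤ w) {B F H : ℝ}
    (hB0 : 0 ≤ B) (hB : ∀ e, u < e → e ≤ w → |∑ k ∈ Icc 1 e, a k - ∑ k ∈ Icc 1 u, a k| ≤ B)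
    (hf0 : ∀ e, 0 ≤ f e) (hfF : ∀ e, f e ≤ F) (hf : ∀ e, u < e → f (e + 1) ≤ f e) (hfw : f (w + 1) = 0)
    (hh0 : ∀ e, u < e → 0 ≤ h e) (hhH : ∀ e, u < e → e ≤ w + 1 → h e ≤ H)
    (hh : ∀ e, u < e → h e ≤ h (e + 1)) :
    |∑ e ∈ Ioc u w, a e * (f e * h e)| ≤ B * (2 * F * H) := by
  set φ : ℕ → ℝ := fun e ↦ f e * h e with hφ
  set A : ℕ → ℝ := fun e ↦ ∑ k ∈ Icc 1 e, a k with hAdef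
  -- Abel: Σ a φ = Σ A (φ e − φ (e+1)) + A w φ (w+1) − A u φ (u+1)
  have habel := sum_Ioc_mul_eq_abel a φ huw
  have hφw : φ (w + 1) = 0 := by simp [hφ, hfw]
  -- centre at A u
  have hcentre : ∑ e ∈ Ioc u w, A u * (φ e - φ (e + 1)) = A u * φ (u + 1) := by
    rw [← Finset.mul_sum, sum_Ioc_sub_succ φ huw, hφw, sub_zero]
  have hmain : ∑ e ∈ Ioc u w, a e * φ e = ∑ e ∈ Ioc u w, (A e - A u) * (φ e - φ (e + 1)) := by
    rw [habel, hφw, mul_zero, add_zero]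
    have : ∑ e ∈ Ioc u w, (A e - A u) * (φ e - φ (e + 1)) =
        ∑ e ∈ Ioc u w, A e * (φ e - φ (e + 1)) - ∑ e ∈ Ioc u w, A u * (φ e - φ (e + 1)) := by
      rw [← Finset.sum_sub_distrib]
      exact Finset.sum_congr rfl fun e _ ↦ by ring
    rw [this, hcentre]
  rw [hmain]
  calc |∑ e ∈ Ioc u w, (A e - A u) * (φ e - φ (e + 1))|
      ≤ ∑ e ∈ Ioc u w, |(A e - A u) * (φ e - φ (e + 1))| := Finset.abs_sum_le_sum_abs _ _
    _ ≤ ∑ e ∈ Ioc u w, B * |φ e - φ (e + 1)| := by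
        refine Finset.sum_le_sum fun e he ↦ ?_
        have he' := Finset.mem_Ioc.1 he
        rw [abs_mul]
        exact mul_le_mul_of_nonneg_right (hB e he'.1 he'.2) (abs_nonneg _)
    _ = B * ∑ e ∈ Ioc u w, |f e * h e - f (e + 1) * h (e + 1)| := by rw [← Finset.mul_sum]
    _ ≤ B * (2 * F * H) :=
        mul_le_mul_of_nonneg_left (sum_abs_prod_sub_le huw hf0 hfF hf hh0 hhH hh) hB0

/-! ### The truncated logarithmic weight -/

/-- `ℓ⁺_Y(e) = max(0, log(Y/e))` (`= log(Y/e)` for `1 ≤ e ≤ Y`, `= 0` for `e > Y`). [folklore] -/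
def ellp (Y : ℝ) (e : ℕ) : ℝ := max 0 (Real.log (Y / e))

/-- `ℓ⁺ ≥ 0`. [folklore] -/
theorem ellp_nonneg (Y : ℝ) (e : ℕ) : 0 ≤ ellp Y e := le_max_left _ _

/-- `ℓ⁺_Y(e) = log(Y/e)` for `1 ≤ e ≤ ⌊Y⌋`. [folklore] -/
theorem ellp_eq_log {Y : ℝ} (hY : 0 ≤ Y) {e : ℕ} (he : e ∈ Icc 1 ⌊Y⌋₊) : ellp Y e = Real.log (Y / e) := by
  have he' := Finset.mem_Icc.1 he
  have he0 : (0 : ℝ) < e := by exact_mod_cast he'.1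
  have heY : (e : ℝ) ≤ Y := le_trans (by exact_mod_cast he'.2) (Nat.floor_le hY)
  exact max_eq_right (Real.log_nonneg ((one_le_div he0).2 heY))

/-- `ℓ⁺_Y(e) ≤ log Y` for `e ≥ 1`, `Y ≥ 1`. [folklore] -/
theorem ellp_le_log {Y : ℝ} (hY : 1 ≤ Y) {e : ℕ} (he : 1 ≤ e) : ellp Y e ≤ Real.log Y := by
  have he0 : (0 : ℝ) < e := by exact_mod_cast he
  refine max_le (Real.log_nonneg hY) ?_
  rw [Real.log_div (by linarith) he0.ne']
  have : 0 ≤ Real.log (e : ℝ) := Real.log_nonneg (by exact_mod_cast he)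
  linarith

/-- `ℓ⁺_Y(0) = 0` (Mathlib conventions) and hence `ℓ⁺_Y(e) ≤ log Y` for all `e` when `Y ≥ 1`. [folklore] -/
theorem ellp_le_log' {Y : ℝ} (hY : 1 ≤ Y) (e : ℕ) : ellp Y e ≤ Real.log Y := by
  rcases Nat.eq_zero_or_pos e with rfl | he
  · simp [ellp, Real.log_nonneg hY]
  · exact ellp_le_log hY he

/-- `ℓ⁺` is antitone in `e ≥ 1`. [folklore] -/
theorem ellp_succ_le {Y : ℝ} (hY : 0 ≤ Y) {e : ℕ} (he : 1 ≤ e) : ellp Y (e + 1) ≤ ellp Y e := by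
  have he0 : (0 : ℝ) < e := by exact_mod_cast he
  unfold ellp
  rcases eq_or_lt_of_le hY with rfl | hY0
  · simp
  refine max_le_max le_rfl (Real.log_le_log (by positivity) ?_)
  exact div_le_div_of_nonneg_left hY he0 (by push_cast; linarith)

/-- `ℓ⁺_Y(e) = 0` for `e ≥ ⌊Y⌋ + 1`. [folklore] -/
theorem ellp_eq_zero {Y : ℝ} (hY : 0 ≤ Y) {e : ℕ} (he : ⌊Y⌋₊ + 1 ≤ e) : ellp Y e = 0 := by
  have hYe : Y < e := lt_of_lt_of_le (Nat.lt_floor_add_one Y) (by exact_mod_cast he)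
  have he0 : (0 : ℝ) < e := lt_of_le_of_lt hY hYe
  unfold ellp
  refine max_eq_left (Real.log_nonpos (div_nonneg hY he0.le) ?_)
  rw [div_le_one he0]; exact hYe.le

/-! ### A uniform bound for the corner weight -/

/-- `E(y) ≤ 𝒲(1) + 1 + |log y|/2` for every `y > 0` (`≤ √y ≤ 1` below `1`, `≤ 𝒲(1) + ½ log y` above).
[folklore] -/
theorem cornerE_le_unif {y : ℝ} (hy : 0 < y) : cornerE y ≤ scriptW 1 + 1 + |Real.log y| / 2 := by
  have hW : 0 ≤ scriptW 1 := scriptW_nonneg zero_le_one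
  have h3 : 0 ≤ |Real.log y| := abs_nonneg _
  rcases le_total 1 y with h | h
  · have := cornerE_le_log h
    have : Real.log y ≤ |Real.log y| := le_abs_self _
    linarith
  · have h1 := cornerE_le_sqrt hy
    have h2 : Real.sqrt y ≤ 1 := Real.sqrt_le_one.mpr h
    linarith

/-! ### The two-variable estimate -/

/-- **The two-variable Abel estimate for the corner double sum.** Let `a` be any real sequence with
`|Σ_{k≤e} a(k)| ≤ B` for all `e` and `|Σ_{k≤e} a(k)| ≤ η` for `e ≥ K₁`; let `Y ≥ 1`, `α > 0`. Then
`|Σ_{k₁,k₂ ≤ Y} a(k₁)a(k₂)ℓ⁺(k₁)²ℓ⁺(k₂)²E(αk₁k₂)| ≤ S·2(log Y)²·(B√(2αK₁Y) + 2η·G)` with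
`S = Σ_{k ≤ Y}|a(k)|ℓ⁺(k)²` and `G = 𝒲(1) + 2 + |log α| + 2 log Y` (a bound for `E` at every argument
`≤ 2αY²`). Rows `k₁ ≤ K₁`: Abel in `k₂`, all arguments `≤ 2αK₁Y` where `E ≤ √·`; rows `k₁ > K₁`: Abel
in `k₁` on `(K₁, Y]`, partial sums `2η`-small. [cite: KowalskiMichelVanderKam2000, Prop. 5.1 — derivation (corner of the diagonal, real-variable form)] -/
theorem abs_doubleSum_cornerE_le {a : ℕ → ℝ} {Y α B η : ℝ} {K₁ : ℕ} (hY : 1 ≤ Y) (hα : 0 < α)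
    (hB : ∀ e : ℕ, |∑ k ∈ Icc 1 e, a k| ≤ B) (hη : ∀ e : ℕ, K₁ ≤ e → |∑ k ∈ Icc 1 e, a k| ≤ η) :
    |∑ k₁ ∈ Icc 1 ⌊Y⌋₊, ∑ k₂ ∈ Icc 1 ⌊Y⌋₊,
        a k₁ * a k₂ * ellp Y k₁ ^ 2 * ellp Y k₂ ^ 2 * cornerE (α * k₁ * k₂)| ≤
      (∑ k ∈ Icc 1 ⌊Y⌋₊, |a k| * ellp Y k ^ 2) * (2 * Real.log Y ^ 2) *
        (B * Real.sqrt (2 * α * K₁ * Y) + 2 * η * (scriptW 1 + 2 + |Real.log α| + 2 * Real.log Y)) := by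
  have hY0 : 0 < Y := by linarith
  set N : ℕ := ⌊Y⌋₊ with hN
  have hN1 : 1 ≤ N := Nat.le_floor (by simpa using hY)
  have hNY : (N : ℝ) ≤ Y := Nat.floor_le hY0.le
  have hYN : Y < N + 1 := Nat.lt_floor_add_one Y
  have hN2Y : (N : ℝ) + 1 ≤ 2 * Y := by linarith
  have hLY : 0 ≤ Real.log Y := Real.log_nonneg hY
  set F : ℝ := Real.log Y ^ 2 with hFdef
  set G : ℝ := scriptW 1 + 2 + |Real.log α| + 2 * Real.log Y with hGdef
  have hW : 0 ≤ scriptW 1 := scriptW_nonneg zero_le_one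
  have hG0 : 0 ≤ G := by rw [hGdef]; positivity
  have hB0 : 0 ≤ B := (abs_nonneg _).trans (hB 0)
  set A : ℕ → ℝ := fun e ↦ ∑ k ∈ Icc 1 e, a k with hAdef
  set S : ℝ := ∑ k ∈ Icc 1 N, |a k| * ellp Y k ^ 2 with hSdef
  have hS0 : 0 ≤ S := Finset.sum_nonneg fun k _ ↦ by positivity
  -- the weight facts
  have hf0 : ∀ e, 0 ≤ ellp Y e ^ 2 := fun e ↦ sq_nonneg _
  have hfF : ∀ e, ellp Y e ^ 2 ≤ F := fun e ↦ by
    rw [hFdef]; exact pow_le_pow_left₀ (ellp_nonneg Y e) (ellp_le_log' hY e) 2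
  have hf : ∀ e, 0 < e → ellp Y (e + 1) ^ 2 ≤ ellp Y e ^ 2 := fun e he ↦
    pow_le_pow_left₀ (ellp_nonneg Y _) (ellp_succ_le hY0.le he) 2
  have hfw : ellp Y (N + 1) ^ 2 = 0 := by rw [ellp_eq_zero hY0.le le_rfl]; ring
  -- E along an arithmetic ray `e ↦ E(c e)`, `c > 0`
  have hE0 : ∀ c : ℝ, 0 < c → ∀ e : ℕ, 0 < e → 0 ≤ cornerE (c * e) := fun c hc e he ↦
    cornerE_nonneg (by positivity)
  have hEmono : ∀ c : ℝ, 0 < c → ∀ e : ℕ, 0 < e → cornerE (c * e) ≤ cornerE (c * (e + 1 : ℕ)) := by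
    intro c hc e he
    exact cornerE_mono (by positivity) (by push_cast; nlinarith)
  -- uniform size of E at arguments ≤ 2αY²
  have hEG : ∀ y : ℝ, 0 < y → y ≤ 2 * α * Y ^ 2 → cornerE y ≤ G := by
    intro y hy hyle
    have h1 := cornerE_le_unif hy
    -- |log y| ≤ |log α| + 2 log Y + log 2 + |log y| lower part... use: log y ≤ log(2αY²), log y ≥ ?
    -- crude: |log y|/2 ≤ ... we bound |log y| ≤ |log α| + 2 log Y + 1 only from above for log y;
    -- for the negative side use E(y) ≤ √y ≤ 1 directly when y ≤ 1.
    rcases le_total y 1 with hy1 | hy1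
    · have := cornerE_le_sqrt hy
      have h2 : Real.sqrt y ≤ 1 := Real.sqrt_le_one.mpr hy1
      rw [hGdef]
      have : 0 ≤ |Real.log α| := abs_nonneg _
      linarith
    · have h2 := cornerE_le_log hy1
      have hlogy : Real.log y ≤ Real.log 2 + Real.log α + 2 * Real.log Y := by
        have := Real.log_le_log hy hyle
        rw [Real.log_mul (by positivity) (by positivity), Real.log_mul (by norm_num) hα.ne',
          Real.log_pow] at this
        push_cast at this
        linarith
      have hl2 : Real.log 2 ≤ 1 := by
        have := Real.log_two_lt_d9; linarith
      have hla : Real.log α ≤ |Real.log α| := le_abs_self _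
      have hla' : 0 ≤ |Real.log α| := abs_nonneg _
      rw [hGdef]
      linarith
  -- split the outer sum at K' = min K₁ N
  set K' : ℕ := min K₁ N with hK'
  have hK'N : K' ≤ N := min_le_right _ _
  have hsplit : ∑ k₁ ∈ Icc 1 N, ∑ k₂ ∈ Icc 1 N,
      a k₁ * a k₂ * ellp Y k₁ ^ 2 * ellp Y k₂ ^ 2 * cornerE (α * k₁ * k₂) =
      ∑ k₁ ∈ Icc 1 K', a k₁ * ellp Y k₁ ^ 2 *
          ∑ k₂ ∈ Ioc 0 N, a k₂ * (ellp Y k₂ ^ 2 * cornerE (α * k₁ * k₂)) +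
        ∑ k₂ ∈ Icc 1 N, a k₂ * ellp Y k₂ ^ 2 *
          ∑ k₁ ∈ Ioc K' N, a k₁ * (ellp Y k₁ ^ 2 * cornerE (α * k₂ * k₁)) := by
    have hIcc : Icc 1 N = Icc 1 K' ∪ Ioc K' N := by
      ext k; simp only [Finset.mem_union, Finset.mem_Icc, Finset.mem_Ioc]; omega
    have hdisj : Disjoint (Icc 1 K') (Ioc K' N) := by
      rw [Finset.disjoint_left]; intro k hk hk'
      simp only [Finset.mem_Icc, Finset.mem_Ioc] at hk hk'; omega
    conv_lhs => arg 1; rw [hIcc]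
    rw [Finset.sum_union hdisj]
    congr 1
    · refine Finset.sum_congr rfl fun k₁ _ ↦ ?_
      rw [Finset.mul_sum, ← Literature.Barriers.Parity.Icc_one_eq_Ioc_zero]
      exact Finset.sum_congr rfl fun k₂ _ ↦ by ring
    · rw [Finset.sum_comm]
      refine Finset.sum_congr rfl fun k₂ _ ↦ ?_
      rw [Finset.mul_sum]
      refine Finset.sum_congr rfl fun k₁ _ ↦ ?_
      rw [show α * (k₂ : ℝ) * k₁ = α * k₁ * k₂ by ring]
      ring
  rw [hsplit]
  -- Part 1: rows k₁ ≤ K'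
  have hpart1 : ∀ k₁ ∈ Icc 1 K',
      |∑ k₂ ∈ Ioc 0 N, a k₂ * (ellp Y k₂ ^ 2 * cornerE (α * k₁ * k₂))| ≤
        B * (2 * F * Real.sqrt (2 * α * K₁ * Y)) := by
    intro k₁ hk₁
    have hk₁' := Finset.mem_Icc.1 hk₁
    have hk₁0 : (0 : ℝ) < k₁ := by exact_mod_cast hk₁'.1
    have hk₁K : (k₁ : ℝ) ≤ K₁ := by exact_mod_cast hk₁'.2.trans (min_le_left _ _)
    have hc : 0 < α * k₁ := by positivity
    have hH : ∀ e : ℕ, 0 < e → e ≤ N + 1 → cornerE (α * k₁ * e) ≤ Real.sqrt (2 * α * K₁ * Y) := by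
      intro e he heN
      have hpos : 0 < α * k₁ * e := by positivity
      refine (cornerE_le_sqrt hpos).trans (Real.sqrt_le_sqrt ?_)
      have heY : (e : ℝ) ≤ 2 * Y := by
        have : (e : ℝ) ≤ N + 1 := by exact_mod_cast heN
        linarith
      calc α * k₁ * e ≤ α * K₁ * (2 * Y) := by gcongr
        _ = 2 * α * K₁ * Y := by ring
    have := abs_sum_Ioc_mul_prod_le a (Nat.zero_le N) (B := B) (F := F)
      (H := Real.sqrt (2 * α * K₁ * Y)) (f := fun e ↦ ellp Y e ^ 2) (h := fun e ↦ cornerE (α * k₁ * e))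
      hB0 (fun e _ _ ↦ by
        rw [Finset.Icc_eq_empty (show ¬ (1 : ℕ) ≤ 0 by norm_num), Finset.sum_empty, sub_zero]
        exact hB e)
      hf0 hfF (fun e he ↦ hf e he) hfw
      (fun e he ↦ hE0 (α * k₁) hc e he) (fun e he heN ↦ hH e he heN)
      (fun e he ↦ hEmono (α * k₁) hc e he)
    exact this
  -- Part 2: columns, Abel in k₁ over (K', N]
  have hη0 : 0 ≤ η := (abs_nonneg _).trans (hη K₁ le_rfl)
  have hpart2 : ∀ k₂ ∈ Icc 1 N,
      |∑ k₁ ∈ Ioc K' N, a k₁ * (ellp Y k₁ ^ 2 * cornerE (α * k₂ * k₁))| ≤ (2 * η) * (2 * F * G) := by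
    intro k₂ hk₂
    have hk₂' := Finset.mem_Icc.1 hk₂
    have hk₂0 : (0 : ℝ) < k₂ := by exact_mod_cast hk₂'.1
    have hk₂N : (k₂ : ℝ) ≤ N := by exact_mod_cast hk₂'.2
    have hc : 0 < α * k₂ := by positivity
    rcases eq_or_lt_of_le hK'N with hKN | hKN
    · rw [hKN]; simp only [Finset.Ioc_self, Finset.sum_empty, abs_zero]
      have hF0 : 0 ≤ F := by positivity
      positivity
    have hK'K : K' = K₁ := by omega
    have hη2 : ∀ e, K' < e → e ≤ N → |A e - A K'| ≤ 2 * η := by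
      intro e he _
      rw [hK'K] at he ⊢
      calc |A e - A K₁| ≤ |A e| + |A K₁| := abs_sub _ _
        _ ≤ η + η := add_le_add (hη e he.le) (hη K₁ le_rfl)
        _ = 2 * η := by ring
    have hH : ∀ e : ℕ, 0 < e → e ≤ N + 1 → cornerE (α * k₂ * e) ≤ G := by
      intro e he heN
      refine hEG _ (by positivity) ?_
      have heY : (e : ℝ) ≤ 2 * Y := by
        have : (e : ℝ) ≤ N + 1 := by exact_mod_cast heN
        linarith
      calc α * k₂ * e ≤ α * Y * (2 * Y) := by gcongr; exact hk₂N.trans hNY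
        _ = 2 * α * Y ^ 2 := by ring
    have := abs_sum_Ioc_mul_prod_le a hK'N (B := 2 * η) (F := F) (H := G)
      (f := fun e ↦ ellp Y e ^ 2) (h := fun e ↦ cornerE (α * k₂ * e))
      (by positivity) (fun e he heN ↦ hη2 e he heN) hf0 hfF (fun e he ↦ hf e (by omega)) hfw
      (fun e he ↦ hE0 (α * k₂) hc e (by omega)) (fun e he heN ↦ hH e (by omega) heN)
      (fun e he ↦ hEmono (α * k₂) hc e (by omega))
    exact this
  -- assemble
  have hS' : ∑ k ∈ Icc 1 K', |a k| * ellp Y k ^ 2 ≤ S := by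
    rw [hSdef]
    exact Finset.sum_le_sum_of_subset_of_nonneg (Finset.Icc_subset_Icc_right hK'N)
      (fun k _ _ ↦ by positivity)
  have h1 : |∑ k₁ ∈ Icc 1 K', a k₁ * ellp Y k₁ ^ 2 *
      ∑ k₂ ∈ Ioc 0 N, a k₂ * (ellp Y k₂ ^ 2 * cornerE (α * k₁ * k₂))| ≤
      S * (B * (2 * F * Real.sqrt (2 * α * K₁ * Y))) := by
    calc |∑ k₁ ∈ Icc 1 K', a k₁ * ellp Y k₁ ^ 2 *
          ∑ k₂ ∈ Ioc 0 N, a k₂ * (ellp Y k₂ ^ 2 * cornerE (α * k₁ * k₂))|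
        ≤ ∑ k₁ ∈ Icc 1 K', |a k₁ * ellp Y k₁ ^ 2 *
          ∑ k₂ ∈ Ioc 0 N, a k₂ * (ellp Y k₂ ^ 2 * cornerE (α * k₁ * k₂))| :=
          Finset.abs_sum_le_sum_abs _ _
      _ ≤ ∑ k₁ ∈ Icc 1 K', |a k₁| * ellp Y k₁ ^ 2 * (B * (2 * F * Real.sqrt (2 * α * K₁ * Y))) := by
          refine Finset.sum_le_sum fun k₁ hk₁ ↦ ?_
          rw [abs_mul, abs_mul, abs_of_nonneg (hf0 k₁)]
          exact mul_le_mul_of_nonneg_left (hpart1 k₁ hk₁) (by positivity)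
      _ = (∑ k₁ ∈ Icc 1 K', |a k₁| * ellp Y k₁ ^ 2) * (B * (2 * F * Real.sqrt (2 * α * K₁ * Y))) := by
          rw [Finset.sum_mul]
      _ ≤ S * (B * (2 * F * Real.sqrt (2 * α * K₁ * Y))) :=
          mul_le_mul_of_nonneg_right hS' (by positivity)
  have h2 : |∑ k₂ ∈ Icc 1 N, a k₂ * ellp Y k₂ ^ 2 *
      ∑ k₁ ∈ Ioc K' N, a k₁ * (ellp Y k₁ ^ 2 * cornerE (α * k₂ * k₁))| ≤
      S * ((2 * η) * (2 * F * G)) := by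
    calc |∑ k₂ ∈ Icc 1 N, a k₂ * ellp Y k₂ ^ 2 *
          ∑ k₁ ∈ Ioc K' N, a k₁ * (ellp Y k₁ ^ 2 * cornerE (α * k₂ * k₁))|
        ≤ ∑ k₂ ∈ Icc 1 N, |a k₂ * ellp Y k₂ ^ 2 *
          ∑ k₁ ∈ Ioc K' N, a k₁ * (ellp Y k₁ ^ 2 * cornerE (α * k₂ * k₁))| :=
          Finset.abs_sum_le_sum_abs _ _
      _ ≤ ∑ k₂ ∈ Icc 1 N, |a k₂| * ellp Y k₂ ^ 2 * ((2 * η) * (2 * F * G)) := by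
          refine Finset.sum_le_sum fun k₂ hk₂ ↦ ?_
          rw [abs_mul, abs_mul, abs_of_nonneg (hf0 k₂)]
          exact mul_le_mul_of_nonneg_left (hpart2 k₂ hk₂) (by positivity)
      _ = S * ((2 * η) * (2 * F * G)) := by rw [Finset.sum_mul]
  calc _ ≤ S * (B * (2 * F * Real.sqrt (2 * α * K₁ * Y))) + S * ((2 * η) * (2 * F * G)) :=
        (abs_add_le _ _).trans (add_le_add h1 h2)
    _ = S * (2 * Real.log Y ^ 2) * (B * Real.sqrt (2 * α * K₁ * Y) + 2 * η * G) := by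
        rw [hFdef]; ring

end Summit.Parity.GeneralizedHardyLittlewood.Theorems.BeyondDiagonalBeatsQuarter.Corner
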